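import Literature.Probability.Process.PoissonBatchLaw
import Literature.Probability.Distributions.ExtendedPoisson
import Mathlib.Probability.Independence.InfinitePi
import HarnessLib

/-!
# Superposition of independent Poisson batches (Kingman 1993 §2.5)

Second step of Kingman's construction of a Poisson process with an s-finite mean measure
`Λ = ∑_n Λ_n`, `Λ_n` finite (J. F. C. Kingman, *Poisson Processes* (1993), §2.5, Existence
Theorem: "construct independent Poisson processes `Π_n` with mean measures `μ_n` and superpose
them", using the Superposition Theorem of §2.2 and its Countable Additivity Theorem for
countably many independent Poisson counts): on the product `Ω = ℕ → ℕ × (ℕ → E)` of the batch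
spaces of `PoissonBatch`, under the product `cloudMeasure m ρ = ⊗_n (𝒫(m_n) ⊗ ρ_n^{⊗ℕ})` of
batch laws,

* `Literature.Probability.Process.truncCount M t ω = ∑_{n<M} #{k < N_n | x_{n,k} ∈ t}` — the
  number of points in `t` of the first `M` batches;
* `Literature.Probability.Process.iIndepFun_truncCount` — for pairwise disjoint measurable
  `t₀, …, t_{q-1}` the truncated counts are independent (batches are independent, and within a
  batch the counts are independent, `PoissonBatchLaw.iIndepFun_batchCount`; the regrouping of an
  independent doubly-indexed family into independent columns is
  `Literature.Probability.Process.iIndepFun_pi_of_prod`);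
* `Literature.Probability.Process.hasLaw_truncCount` — `truncCount M t ~ 𝒫(∑_{n<M} m_n ρ_n(t))`
  (sums of independent Poisson variables, Mathlib's `IndepFun.hasLaw_add_poissonMeasure`, and
  `Literature.Probability.Distributions.poissonMeasure_zero` of `ExtendedPoisson` for `M = 0`).

The passage `M → ∞` (laws of the total counts) is in `PoissonSuperpositionLimit`.
-/

noncomputable section

open MeasureTheory ProbabilityTheory Finset
open scoped ENNReal NNReal

namespace Literature.Probability.Process

/-! ### Two lemmas on independent families -/

section IndepLemmas

variable {Ω Ω' : Type*} [MeasurableSpace Ω] [MeasurableSpace Ω']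

/-- Independence is transported along a map `g` pushing `P` to `P'`: if `(f_i)` are independent
under `P' = g_* P` then `(f_i ∘ g)` are independent under `P`. [folklore] -/
theorem iIndepFun_comp_of_map_eq {ι : Type*} [Fintype ι] {β : ι → Type*} [∀ i, MeasurableSpace (β i)]
    {P : Measure Ω} [IsProbabilityMeasure P] {P' : Measure Ω'} {f : ∀ i, Ω' → β i} {g : Ω → Ω'}
    (hg : Measurable g) (hmap : P.map g = P') (hf : ∀ i, Measurable (f i)) (h : iIndepFun f P') :
    iIndepFun (fun i ω ↦ f i (g ω)) P := by
  refine (iIndepFun_iff_map_fun_eq_pi_map (f := fun i ω ↦ f i (g ω))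
    fun i ↦ ((hf i).comp hg).aemeasurable).2 ?_
  have h1 : P.map (fun ω i ↦ f i (g ω)) = (P.map g).map (fun ω' i ↦ f i ω') :=
    (Measure.map_map (measurable_pi_lambda _ hf) hg).symm
  rw [h1, hmap, h.map_fun_eq_pi_map fun i ↦ (hf i).aemeasurable]
  congr 1
  funext i
  rw [← hmap, Measure.map_map (hf i) hg]
  rfl

/-- **Columns of an independent array are independent**: if the random variables `X i j`,
`(i, j) ∈ ι × κ`, are independent, then so are the random vectors `(X i j)_j`, `i ∈ ι`
(regrouping; the product measure over `ι × κ` is the product over `i` of the products over `j`,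
Mathlib's `Measure.infinitePi_map_piCurry`). [folklore] -/
theorem iIndepFun_pi_of_prod {ι κ β : Type*} [MeasurableSpace β] {P : Measure Ω} [IsProbabilityMeasure P]
    {X : ι → κ → Ω → β} (mX : ∀ i j, Measurable (X i j))
    (h : iIndepFun (fun p : ι × κ ↦ X p.1 p.2) P) :
    iIndepFun (fun i ω ↦ fun j ↦ X i j ω) P := by
  have hprob : ∀ i j, IsProbabilityMeasure (P.map (X i j)) :=
    fun i j ↦ Measure.isProbabilityMeasure_map (mX i j).aemeasurable
  have hSigma : iIndepFun (fun p : (_ : ι) × κ ↦ X p.1 p.2) P :=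
    h.precomp (g := fun p : (_ : ι) × κ ↦ (p.1, p.2)) (Equiv.sigmaEquivProd ι κ).injective
  have hrow : ∀ i, iIndepFun (X i) P := fun i ↦
    h.precomp (g := fun j ↦ (i, j)) (Prod.mk_right_injective i)
  rw [iIndepFun_iff_map_fun_eq_infinitePi_map fun i ↦ measurable_pi_lambda _ (mX i)]
  have hcurry : (fun ω i j ↦ X i j ω) =
      (MeasurableEquiv.piCurry fun (_ : ι) (_ : κ) ↦ β) ∘ fun ω (p : (_ : ι) × κ) ↦ X p.1 p.2 ω := by
    ext ω i j
    simp [Sigma.curry]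
  have hmX : ∀ p : (_ : ι) × κ, Measurable (X p.1 p.2) := fun p ↦ mX p.1 p.2
  have hmeasS : Measurable fun ω (p : (_ : ι) × κ) ↦ X p.1 p.2 ω := measurable_pi_lambda _ hmX
  have hlaw := hSigma.map_fun_eq_infinitePi_map hmX
  rw [hcurry, ← Measure.map_map (MeasurableEquiv.measurable _) hmeasS, hlaw,
    Measure.infinitePi_map_piCurry (fun i j ↦ P.map (X i j))]
  congr 1
  funext i
  exact ((hrow i).map_fun_eq_infinitePi_map (mX i)).symm

end IndepLemmas

/-! ### The product of the batch spaces -/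

section Superposition

variable {E : Type*} [MeasurableSpace E]

/-- **The law of a sequence of independent Poisson batches** `(N_n, (x_{n,k})_k)_n`, the `n`-th
with `N_n ~ 𝒫(m_n)` and marks of law `ρ_n`: the product measure `⊗_n (𝒫(m_n) ⊗ ρ_n^{⊗ℕ})`
on `ℕ → ℕ × (ℕ → E)` (Kingman 1993 §2.5: "independent Poisson processes `Π_n`").
[cite: Kingman1993, §2.5 Existence Theorem] -/
def cloudMeasure (m : ℕ → ℝ≥0) (ρ : ℕ → Measure E) [∀ n, IsProbabilityMeasure (ρ n)] :
    Measure (ℕ → ℕ × (ℕ → E)) :=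
  Measure.infinitePi fun n ↦ batchMeasure (m n) (ρ n)

/-- The law of a sequence of independent batches is a probability measure. [folklore] -/
instance isProbabilityMeasure_cloudMeasure (m : ℕ → ℝ≥0) (ρ : ℕ → Measure E)
    [∀ n, IsProbabilityMeasure (ρ n)] : IsProbabilityMeasure (cloudMeasure m ρ) := by
  unfold cloudMeasure
  infer_instance

/-- The `n`-th batch has law `𝒫(m_n) ⊗ ρ_n^{⊗ℕ}` under the cloud measure. [folklore] -/
theorem cloudMeasure_map_eval (m : ℕ → ℝ≥0) (ρ : ℕ → Measure E) [∀ n, IsProbabilityMeasure (ρ n)] (n : ℕ) :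
    (cloudMeasure m ρ).map (fun ω ↦ ω n) = batchMeasure (m n) (ρ n) :=
  Measure.infinitePi_map_eval _ n

/-- **The number of points in `t` of the first `M` batches**,
`∑_{n<M} #{k < N_n | x_{n,k} ∈ t}`. [cite: Kingman1993, §2.5 Existence Theorem] -/
def truncCount (M : ℕ) (t : Set E) (ω : ℕ → ℕ × (ℕ → E)) : ℕ :=
  ∑ n ∈ range M, batchCount t (ω n)

omit [MeasurableSpace E] in
/-- The truncated counts increase with the number of batches. [folklore] -/
theorem truncCount_mono (t : Set E) (ω : ℕ → ℕ × (ℕ → E)) : Monotone fun M ↦ truncCount M t ω :=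
  fun _ _ h ↦ Finset.sum_le_sum_of_subset (Finset.range_mono h)

omit [MeasurableSpace E] in
/-- Adding one batch. [folklore] -/
theorem truncCount_succ (M : ℕ) (t : Set E) :
    truncCount (M + 1) t = truncCount M t + fun ω ↦ batchCount t (ω M) := by
  funext ω
  simp [truncCount, Finset.sum_range_succ]

/-- The truncated counts are measurable. [folklore] -/
@[fun_prop]
theorem measurable_truncCount (M : ℕ) {t : Set E} (ht : MeasurableSet t) : Measurable (truncCount M t) :=
  Finset.measurable_sum _ fun n _ ↦ (measurable_batchCount ht).comp (measurable_pi_apply n)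

variable (m : ℕ → ℝ≥0) (ρ : ℕ → Measure E) [∀ n, IsProbabilityMeasure (ρ n)]

/-- The counts of the individual batches in a fixed set are independent. [folklore] -/
theorem iIndepFun_batchCount_eval {t : Set E} (ht : MeasurableSet t) :
    iIndepFun (fun n (ω : ℕ → ℕ × (ℕ → E)) ↦ batchCount t (ω n)) (cloudMeasure m ρ) :=
  iIndepFun_infinitePi (P := fun n ↦ batchMeasure (m n) (ρ n)) (X := fun _ b ↦ batchCount t b)
    fun _ ↦ measurable_batchCount ht

variable {q : ℕ} {s : Fin q → Set E}

/-- **The truncated counts in pairwise disjoint measurable sets are independent** (the batches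
are independent and, within a batch, the counts are independent, `iIndepFun_batchCount`;
Kingman 1993 §2.5 with the Superposition Theorem §2.2). [cite: Kingman1993, §2.5 Existence Theorem] -/
theorem iIndepFun_truncCount (hm : ∀ i, MeasurableSet (s i)) (hd : Pairwise (Function.onFun Disjoint s))
    (M : ℕ) : iIndepFun (fun i ω ↦ truncCount M (s i) ω) (cloudMeasure m ρ) := by
  have mX : ∀ (i : Fin q) (n : ℕ), Measurable fun ω : ℕ → ℕ × (ℕ → E) ↦ batchCount (s i) (ω n) :=
    fun i n ↦ (measurable_batchCount (hm i)).comp (measurable_pi_apply n)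
  -- the batches are independent
  have hrow : iIndepFun (fun n (ω : ℕ → ℕ × (ℕ → E)) ↦ fun i ↦ batchCount (s i) (ω n)) (cloudMeasure m ρ) :=
    iIndepFun_infinitePi (P := fun n ↦ batchMeasure (m n) (ρ n)) (X := fun _ b i ↦ batchCount (s i) b)
      fun _ ↦ measurable_batchCountVec hm
  -- within a batch the counts are independent
  have hwithin : ∀ n, iIndepFun (fun i (ω : ℕ → ℕ × (ℕ → E)) ↦ batchCount (s i) (ω n)) (cloudMeasure m ρ) :=
    fun n ↦ iIndepFun_comp_of_map_eq (measurable_pi_apply n) (cloudMeasure_map_eval m ρ n)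
      (fun i ↦ measurable_batchCount (hm i)) (iIndepFun_batchCount (m n) (ρ n) hm hd)
  -- hence the doubly-indexed family is independent
  have hpair : iIndepFun (fun (p : ℕ × Fin q) (ω : ℕ → ℕ × (ℕ → E)) ↦ batchCount (s p.2) (ω p.1))
      (cloudMeasure m ρ) :=
    iIndepFun_uncurry' (X := fun n i (ω : ℕ → ℕ × (ℕ → E)) ↦ batchCount (s i) (ω n)) (fun n i ↦ mX i n)
      hrow hwithin
  -- so its columns are independent, and so are their partial sums
  have hcol : iIndepFun (fun i (ω : ℕ → ℕ × (ℕ → E)) ↦ fun n ↦ batchCount (s i) (ω n)) (cloudMeasure m ρ) :=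
    iIndepFun_pi_of_prod (X := fun i n (ω : ℕ → ℕ × (ℕ → E)) ↦ batchCount (s i) (ω n)) mX
      (hpair.precomp (g := fun p : Fin q × ℕ ↦ (p.2, p.1)) fun _ _ h ↦ by
        simpa [Prod.ext_iff, and_comm] using h)
  exact hcol.comp (fun _ v ↦ ∑ n ∈ range M, v n) fun _ ↦ Finset.measurable_sum _ fun n _ ↦ measurable_pi_apply n

/-- **The truncated counts are Poisson**: `truncCount M t ~ 𝒫(∑_{n<M} m_n ρ_n(t))` for measurable
`t` (sum of independent Poisson variables; Kingman 1993 §2.2 Superposition Theorem, §2.5).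
[cite: Kingman1993, §2.5 Existence Theorem] -/
theorem hasLaw_truncCount {t : Set E} (ht : MeasurableSet t) (M : ℕ) :
    HasLaw (truncCount M t) (poissonMeasure (∑ n ∈ range M, m n * (ρ n t).toNNReal)) (cloudMeasure m ρ) := by
  induction M with
  | zero =>
    refine ⟨aemeasurable_const, ?_⟩
    rw [Finset.sum_range_zero, Literature.Probability.Distributions.poissonMeasure_zero]
    have : truncCount 0 t = fun _ : ℕ → ℕ × (ℕ → E) ↦ 0 := by
      funext ω
      simp [truncCount]
    rw [this, Measure.map_const, measure_univ, one_smul]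
  | succ M ih =>
    rw [truncCount_succ, Finset.sum_range_succ]
    refine IndepFun.hasLaw_add_poissonMeasure ?_ ih ?_
    · have h := (iIndepFun_batchCount_eval m ρ ht).indepFun_finsetSum_of_notMem
        (fun n ↦ (measurable_batchCount ht).comp (measurable_pi_apply n)) (s := range M) (i := M) (by simp)
      have hfun : ∑ j ∈ range M, (fun (ω : ℕ → ℕ × (ℕ → E)) ↦ batchCount t (ω j)) = truncCount M t := by
        funext ω
        simp [truncCount, Finset.sum_apply]
      rwa [hfun] at h
    · exact (hasLaw_batchCount (m M) (ρ M) ht).fun_comp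
        ⟨(measurable_pi_apply M).aemeasurable, cloudMeasure_map_eval m ρ M⟩

end Superposition

end Literature.Probability.Process

end
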